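import Summits.NavierStokesRegularity.NavierStokesRegularity.Theorems.PerpetualPumpEulerTypeIGlueSobolevR3

/-!
# Route PumpContinuation · `BoundedTemperatureClosed` — Schwartz divergence-free data are `H¹⁰_df` data

Support file for the crux `BoundedTemperatureClosed` (stmt-NavierStokesRegularity-18303), line
`SketchIdeator4`, registered stub `stub_schwartzSubH10`: the data-class inclusion
`schwartzData ⊆ h10Data`.  For a real divergence-free Schwartz field `u₀ : 𝓢(ℝ³, ℝ³)` the `L²`
class `schwartzL2 u₀` of its complexification `u₀^ℂ` lies in Tao's class `H¹⁰_df(ℝ³)`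
(`MemH10df`: finite Fourier-side `H¹⁰` norm, real, Fourier-divergence-free).

Proof: every derivative of a Schwartz field is square-integrable
(`lintegral_enorm_iteratedFDeriv_sq_lt_top_schwartz`: `‖Dʲu₀(x)‖ ≤ p_{0,j}(u₀)` pointwise and
`x ↦ ‖Dʲu₀(x)‖` is integrable, so `∫ ‖Dʲu₀‖² ≤ p_{0,j}(u₀) · ∫ ‖Dʲu₀‖ < ∞`), hence the landed
`memH10df_toLp_complexify` (smooth, divergence-free, `u₀, …, D¹⁰u₀ ∈ L²` ⟹ `[u₀^ℂ] ∈ H¹⁰_df`)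
applies with the `L²` witness `memLp_complexify_comp u₀`, whose `toLp` class is `schwartzL2 u₀` by
definition.

## Main statements

* `lintegral_enorm_iteratedFDeriv_sq_lt_top_schwartz` — `∫ ‖Dʲf‖² dμ < ∞` for a Schwartz map `f` and a
  measure of temperate growth `μ`.
* `memH10df_schwartzL2` — `schwartzL2 u₀ ∈ H¹⁰_df` for divergence-free Schwartz `u₀`.
* `stub_schwartzSubH10` — the registered stub of line `SketchIdeator4` (verbatim signature).

## References

* T. Tao, J. Amer. Math. Soc. 29 (2016), arXiv:1402.0290v3, §1.1 p. 3 (`H¹⁰_df`), Thm. 1.5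
  (Schwartz divergence-free data). [Tao2016AveragedNS]
-/

noncomputable section

open MeasureTheory Set Filter Topology
open scoped ENNReal NNReal SchwartzMap ContDiff

-- the nested summit namespace `…NavierStokesRegularity.NavierStokesRegularity…` is the tree's layout,
-- so the duplicated-namespace linter must be silenced for every declaration below
set_option linter.dupNamespace false

namespace Summit.NavierStokesRegularity.NavierStokesRegularity.Theorems.PumpContinuationSchwartzData

open Literature.Analysis.FluidPDE Literature.Analysis.FluidPDE.Tao2016

/-- **Every derivative of a Schwartz map is square-integrable**: for a Schwartz map `f : 𝓢(E, F)`
and a measure `μ` of temperate growth on `E`, `∫ ‖Dⁿf(x)‖² dμ < ∞` for every `n`.  Proof: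
`‖Dⁿf(x)‖ ≤ p_{0,n}(f)` pointwise (`SchwartzMap.norm_iteratedFDeriv_le_seminorm`) and
`x ↦ ‖Dⁿf(x)‖` is `μ`-integrable (`SchwartzMap.integrable_pow_mul_iteratedFDeriv` with weight
`‖x‖⁰`), so `∫ ‖Dⁿf‖² ≤ p_{0,n}(f) ∫ ‖Dⁿf‖ < ∞`. [folklore] -/
theorem lintegral_enorm_iteratedFDeriv_sq_lt_top_schwartz {E F : Type*} [NormedAddCommGroup E]
    [NormedSpace ℝ E] [MeasurableSpace E] [BorelSpace E] [SecondCountableTopology E]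
    [NormedAddCommGroup F] [NormedSpace ℝ F] (μ : Measure E) [μ.HasTemperateGrowth]
    (f : 𝓢(E, F)) (n : ℕ) :
    ∫⁻ x, ‖iteratedFDeriv ℝ n f x‖ₑ ^ 2 ∂μ < ⊤ := by
  have hC : ∀ x, ‖iteratedFDeriv ℝ n f x‖ ≤ SchwartzMap.seminorm ℝ 0 n f :=
    SchwartzMap.norm_iteratedFDeriv_le_seminorm ℝ f n
  have hint : Integrable (fun x => ‖iteratedFDeriv ℝ n f x‖) μ := by
    simpa using SchwartzMap.integrable_pow_mul_iteratedFDeriv μ f 0 n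
  have hfin : ∫⁻ x, ‖iteratedFDeriv ℝ n f x‖ₑ ∂μ < ⊤ := by
    simpa only [hasFiniteIntegral_iff_enorm, enorm_norm] using hint.hasFiniteIntegral
  calc ∫⁻ x, ‖iteratedFDeriv ℝ n f x‖ₑ ^ 2 ∂μ
      ≤ ∫⁻ x, ENNReal.ofReal (SchwartzMap.seminorm ℝ 0 n f) * ‖iteratedFDeriv ℝ n f x‖ₑ ∂μ := by
        refine lintegral_mono fun x => ?_
        rw [sq]
        gcongr
        rw [← ofReal_norm]
        exact ENNReal.ofReal_le_ofReal (hC x)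
    _ = ENNReal.ofReal (SchwartzMap.seminorm ℝ 0 n f) * ∫⁻ x, ‖iteratedFDeriv ℝ n f x‖ₑ ∂μ :=
        lintegral_const_mul' _ _ ENNReal.ofReal_ne_top
    _ < ⊤ := ENNReal.mul_lt_top ENNReal.ofReal_lt_top hfin

/-- **Schwartz divergence-free data are `H¹⁰_df` data**: for a real divergence-free Schwartz field
`u₀ : 𝓢(ℝ³, ℝ³)`, the `L²(ℝ³; ℂ³)` class `schwartzL2 u₀` of its complexification lies in Tao's
`H¹⁰_df(ℝ³)` — finite `H¹⁰` norm, real, and Fourier-divergence-free (Tao 2016, §1.1 p. 3: the data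
of Thm. 1.5 are "Schwartz divergence-free vector fields", which lie in `H¹⁰_df`).  From the landed
`memH10df_toLp_complexify` (smooth divergence-free fields with `u₀, …, D¹⁰u₀ ∈ L²`) and
`lintegral_enorm_iteratedFDeriv_sq_lt_top_schwartz`. [cite: Tao2016AveragedNS, §1.1 p. 3] -/
theorem memH10df_schwartzL2 (u₀ : 𝓢(EuclideanSpace ℝ (Fin 3), EuclideanSpace ℝ (Fin 3)))
    (hdiv : VectorCalculus.IsDivFree ⇑u₀) : MemH10df (schwartzL2 u₀) :=
  PerpetualPumpEulerTypeIGlue.memH10df_toLp_complexify (u₀.smooth ⊤) hdiv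
    (fun j _ => lintegral_enorm_iteratedFDeriv_sq_lt_top_schwartz volume u₀ j)
    (memLp_complexify_comp u₀)

/-- Registered stub `stub_schwartzSubH10` of line `SketchIdeator4` (crux `BoundedTemperatureClosed`):
complexified divergence-free Schwartz fields are `H¹⁰_df` data (`memH10df_schwartzL2`).
[cite: Tao2016AveragedNS, §1.1 p. 3] -/
theorem stub_schwartzSubH10 :
    ∀ u₀ : SchwartzMap (EuclideanSpace ℝ (Fin 3)) (EuclideanSpace ℝ (Fin 3)),
      VectorCalculus.IsDivFree ⇑u₀ → MemH10df (schwartzL2 u₀) :=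
  fun u₀ h => memH10df_schwartzL2 u₀ h

end Summit.NavierStokesRegularity.NavierStokesRegularity.Theorems.PumpContinuationSchwartzData

end
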